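/-
Copyright (c) 2026 the pub-hodgecm-mathlib formalisation cell (harness21).  Prover seat hodgecm-mathlib-K2E3-p14 (g8), HCML Track B «K2-LIT» (build stream 29),
h413 = `stmt-HodgeConjecture-24833`, line `K2_E3_EllipticInputs`, PART «SC» (SC-an)₂ ∕ M5h₂ cone (L4 LINE-LEAD K2E3-plan (g4), D141 FILE 2 DOCK): (M5d)₂ «THE EXPLICIT
RADIUS» IN ★ [M4]'s COEFFICIENT CURRENCY at `U(σ, Φ₂)(K)` — ★ p861231 `…Thm20RadiusTwo` (hypothesis-first) docked on K2E3-p32 (g0)'s THEOREM 20 for `U(1,1)`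
(`K2E3CuspFormCancellationU2LevelOne`) and K2E3-p37 (g0)'s ★ slice cuspidality (`K2E3SupercuspOrbitalSliceCuspidalModelTwo`).  2026-09-04.
-/
import Summits.HodgeConjecture.HodgeConjecture.Theorems.K2E3SupercuspidalTruncatedCharThm20RadiusTwo   -- ★ p861231 (this seat): `setIntegral_sdiff_heightBall_conj_eq_zero_of_levelOne`, `truncated_conj_eq_inter_and_tendsto_of_levelOne` (any rank, hypothesis-first on Theorem 20)
import Summits.HodgeConjecture.HodgeConjecture.Theorems.K2E3CuspFormCancellationU2LevelOne             -- ★ (K2E3-p32 (g0), D137) THEOREM 20 for `U(σ, Φ₂)(K)` on the full level `K₁`: `cuspForm_cancellation_levelOne_U2`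
import Summits.HodgeConjecture.HodgeConjecture.Theorems.K2E3SupercuspOrbitalSliceCuspidalModelTwo     -- ★ p861233 (K2E3-p37 (g0)) [M1]₂: `integral_coeff_slice_unipotentU_eq_zero_of_isSupercuspidal` (+ `…_map_conj_weylLongU_…`), `continuous_coeff_conj`
import Literature.NumberTheory.Automorphic.ReductionTheoryGLnConjugation                                -- ★ `isClosed_upperUnitriangular` (`N` is closed)
import HarnessLib

/-!
# K2_E3 road (h413), socket (SC-an)₂, M5h₂ piece (M5d)₂ DOCK: the explicit-radius shell vanishing and truncation shapes for the supercuspidal coefficients of `U(1,1)`,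
# with ★ [M4]∕(M5d)'s binder list `3 ↦ 2` (the `hM5d` letter of ★ `K2E3SupercuspidalTruncatedCharRadiusDatumTwo`)

Cell `pub/hodgecm-mathlib`, Track B «K2-LIT», crux H413 = `stmt-HodgeConjecture-24833` (`--supports … --as helper`, count-neutral); L4 LINE-LEAD K2E3-plan (g4) D141 FILE 2;
consumers: K2E3-p36 (g0) ★ `K2E3SupercuspidalTruncatedCharRadiusDatumTwo` (`hM5d` :216–:240 = the first head below, BY SHAPE), the (M5h₂) payer.  THEOREMS ONLY; ★-only imports.

THE TWO HEADS are ★ `K2E3SupercuspidalTruncatedCharThm20Radius.setIntegral_sdiff_heightBall_coeff_conj_eq_zero_of_subset` ∕ `truncatedCoeff_eq_inter_and_tendsto_of_subset` with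
`Fin 3 ↦ Fin 2`, SAME binder order (the binders `hσ`, `h2` of the `N = 3` statement are idle at rank one — the ★ rank-one slice cuspidality needs neither — and are kept as
`_`-binders so that the socket shape is the literal `3 ↦ 2` image).  PROOF = ★ [M4]'s: Haar measures `ν`, `ν̄` on the closed subgroups `N`, `N̄` (★ `isClosed_upperUnitriangular`),
the slice `f_t(x) = B u′ (ρ(x t x⁻¹) u)` is continuous and a cusp form along `N` and `N̄` (★ p861233), THEOREM 20 on `K₁` with the explicit radius (★ K2E3-p32 (g0)
`cuspForm_cancellation_levelOne_U2`), then ★ p861231 (this seat) does the shell ∕ truncation packaging.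
[HarishChandra1970, Part VII §2 Theorem 20 p. 70; §3 p. 71 eq. (1), (ii), p. 72] [Rogawski1990, §4.9 p. 54]

HONEST LABEL: HC_CM is proved only modulo the 7 printed citations (2 remaining named inputs: hLiu418 = stmt-HodgeConjecture-24832, h413 = stmt-HodgeConjecture-24833)
until rung 0 closes; count-neutral helper ((SC-an)₂ NOT ★).

## References
* [HarishChandra1970] Harish-Chandra (notes by G. van Dijk), *Harmonic Analysis on Reductive p-adic Groups*, LNM 162 (1970), Part VII §2 Theorem 20 p. 70;
  §3 p. 71 eq. (1) and (ii), p. 72.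
* [Rogawski1990] J. D. Rogawski, *Automorphic Representations of Unitary Groups in Three Variables*, Ann. of Math. Stud. 123 (1990), §1.10 p. 9, §4.9 p. 54.
* [Folland1995] G. B. Folland, *A Course in Abstract Harmonic Analysis* (1995), §2.4, §2.6.
-/

set_option autoImplicit false
-- the mandated namespace repeats the single-problem summit's segment (`HodgeConjecture.HodgeConjecture`)
set_option linter.dupNamespace false

noncomputable section

open MeasureTheory Measure Set Filter Topology
open scoped NNReal ENNReal Pointwise Matrix MatrixGroups WithZero
open ValuativeRel
open Literature.NumberTheory.Automorphic Literature.NumberTheory.Automorphic.UnitaryGroup Literature.NumberTheory.Rogawski1990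

namespace Summit.HodgeConjecture.HodgeConjecture.Cruxes.H413.K2E3SupercuspidalTruncatedCharThm20RadiusTwoCoeff

variable {K : Type*} [Field K] [Valued K ℤᵐ⁰] [ValuativeRel K] [(Valued.v : Valuation K ℤᵐ⁰).Compatible] [IsNonarchimedeanLocalField K]

set_option synthInstance.maxHeartbeats 400000 in
set_option maxHeartbeats 1600000 in
-- instance-term unification on the model carriers (same class and values as ★ [M4] ∕ (M5d))
/-- **(M5d)₂ THE SHELL VANISHING WITH EXPLICIT RADIUS** at `U(σ, Φ₂)(K)`: for `g = y t y⁻¹` (`t = diag d` regular, `y ∈ Ω s`), `θ = B u' (ρ(·) u)` a coefficient of a smooth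
supercuspidal `ρ` whose slice `f_t(x) = θ(x t x⁻¹)` is supported in `C·T` with `C ⊆ Ω m_C`, `μ` a left- and right-invariant Haar measure and `Ω` the height-ball exhaustion:
**`∫_{Ω n ∖ Ω (m_C + (1 + 2s + 4m_C) + s)} θ(x g x⁻¹) dμ(x) = 0` for EVERY `n`** — the `3 ↦ 2` image of ★ (M5d)'s head (binders `hσ`, `h2` idle at rank one), i.e. K2E3-p36 (g0)'s
`hM5d` letter; proof: ★ p861233 slice cusp form + ★ K2E3-p32 (g0) Theorem 20 on `K₁` + ★ p861231 packaging.
[cite: HarishChandra1970, Part VII §2 Theorem 20 p. 70; §3 p. 71 eq. (1), (ii)] [cite: Rogawski1990, §4.9 p. 54] -/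
theorem setIntegral_sdiff_heightBall_coeff_conj_eq_zero_of_subset [SecondCountableTopology K] [SecondCountableTopology (GL (Fin 2) K)]
    [MeasurableSpace K] [BorelSpace K]
    (σ : K →+* K) (_hσ : ∀ x, σ (σ x) = x) (hσc : Continuous σ) (hσv : ∀ x, Valued.v (σ x) = Valued.v x) (_h2 : (2 : K) ≠ 0)
    {J : Matrix (Fin 2) (Fin 2) K} (hJ : J = (StdForm.antidiagonal 2).over K)
    [MeasurableSpace ↥(unitaryGroupOfForm σ J)] [BorelSpace ↥(unitaryGroupOfForm σ J)]
    [SecondCountableTopology ↥(unitaryGroupOfForm σ J)] [LocallyCompactSpace ↥(unitaryGroupOfForm σ J)]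
    (μ : Measure ↥(unitaryGroupOfForm σ J)) [μ.IsHaarMeasure] [μ.IsMulRightInvariant]
    {ϖ : K} (hϖ : Valued.v ϖ = WithZero.exp (-1 : ℤ)) {ϖ' : K} (hϖ'0 : ϖ' ≠ 0) (hϖ'1 : valuation K ϖ' < 1) (hσϖ' : σ ϖ' = ϖ')
    (hZs : ∀ z ∈ Subgroup.center ↥(unitaryGroupOfForm σ J), ∃ c : Kˣ,
      ((z : ↥(unitaryGroupOfForm σ J)) : GL (Fin 2) K) = Matrix.GeneralLinearGroup.scalar (Fin 2) c)
    (hZc : IsCompact ((Subgroup.center ↥(unitaryGroupOfForm σ J) : Subgroup ↥(unitaryGroupOfForm σ J)) : Set ↥(unitaryGroupOfForm σ J)))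
    (Ω : CompactExhaustion ↥(unitaryGroupOfForm σ J))
    (hmem : ∀ (m : ℕ) (g : ↥(unitaryGroupOfForm σ J)), g ∈ Ω m ↔
      (∀ i j, Valued.v (ϖ ^ m * ((g : GL (Fin 2) K) : Matrix (Fin 2) (Fin 2) K) i j) ≤ 1) ∧
        ∀ i j, Valued.v (ϖ ^ m * (((g : GL (Fin 2) K)⁻¹ : GL (Fin 2) K) : Matrix (Fin 2) (Fin 2) K) i j) ≤ 1)
    (hinv : ∀ (m : ℕ) (g : ↥(unitaryGroupOfForm σ J)), g ∈ Ω m → g⁻¹ ∈ Ω m)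
    (hmul : ∀ (a b : ℕ) (g h : ↥(unitaryGroupOfForm σ J)), g ∈ Ω a → h ∈ Ω b → g * h ∈ Ω (a + b))
    {V : Type*} [AddCommGroup V] [Module ℂ V] (ρ : Representation ℂ ↥(unitaryGroupOfForm σ J) V) (hsm : ρ.IsSmooth) (hsc : ρ.IsSupercuspidal)
    (B : V →ₗ⋆[ℂ] V →ₗ[ℂ] ℂ) (hBinv : ∀ (g : ↥(unitaryGroupOfForm σ J)) (x y : V), B (ρ g x) (ρ g y) = B x y) (u u' : V)
    (t : ↥(unitaryGroupOfForm σ J)) {d : Fin 2 → Kˣ} (hd : glDiagonal 2 K d = (t : GL (Fin 2) K)) (hreg : IsRegularElt (t : GL (Fin 2) K))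
    (C : Set ↥(unitaryGroupOfForm σ J)) {mC : ℕ} (hCΩ : C ⊆ Ω mC)
    (hsupp : ∀ x : ↥(unitaryGroupOfForm σ J), B u' (ρ (x * t * x⁻¹) u) ≠ 0 →
      x ∈ C * ((torusU σ J : Subgroup ↥(unitaryGroupOfForm σ J)) : Set ↥(unitaryGroupOfForm σ J)))
    {s : ℕ} {y : ↥(unitaryGroupOfForm σ J)} (hy : y ∈ Ω s) (n : ℕ) :
    ∫ x in Ω n \ Ω (mC + (1 + 2 * s + 4 * mC) + s), B u' (ρ (x * (y * t * y⁻¹) * x⁻¹) u) ∂μ = 0 := by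
  haveI : T2Space K := (Literature.NumberTheory.GaloisRepresentations.IsNonarchimedeanLocalField.isLocalField K).toT2Space
  -- `N` and `N̄` are closed subgroups of the locally compact `U`: Haar measures on both
  have hN : IsClosed (((borelTriple σ J hJ).N : Subgroup ↥(unitaryGroupOfForm σ J)) : Set ↥(unitaryGroupOfForm σ J)) :=
    (isClosed_upperUnitriangular (n := 2) (R := K)).preimage continuous_subtype_val
  have hNbar : IsClosed ((((borelTriple σ J hJ).N).map (MulAut.conj (weylLongU σ hJ)).toMonoidHom : Subgroup ↥(unitaryGroupOfForm σ J)) :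
      Set ↥(unitaryGroupOfForm σ J)) := by
    have himg : ((((borelTriple σ J hJ).N).map (MulAut.conj (weylLongU σ hJ)).toMonoidHom : Subgroup ↥(unitaryGroupOfForm σ J)) :
        Set ↥(unitaryGroupOfForm σ J)) =
        ((Homeomorph.mulLeft (weylLongU σ hJ)).trans (Homeomorph.mulRight (weylLongU σ hJ)⁻¹)) ''
          (((borelTriple σ J hJ).N : Subgroup ↥(unitaryGroupOfForm σ J)) : Set ↥(unitaryGroupOfForm σ J)) := by
      rw [Subgroup.coe_map]
      rfl
    rw [himg]
    exact (Homeomorph.isClosed_image _).2 hN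
  haveI : LocallyCompactSpace ↥((borelTriple σ J hJ).N) := hN.isClosedEmbedding_subtypeVal.locallyCompactSpace
  haveI : LocallyCompactSpace ↥(((borelTriple σ J hJ).N).map (MulAut.conj (weylLongU σ hJ)).toMonoidHom) :=
    hNbar.isClosedEmbedding_subtypeVal.locallyCompactSpace
  haveI : SecondCountableTopology ↥((borelTriple σ J hJ).N) := TopologicalSpace.Subtype.secondCountableTopology _
  haveI : SecondCountableTopology ↥(((borelTriple σ J hJ).N).map (MulAut.conj (weylLongU σ hJ)).toMonoidHom) :=
    TopologicalSpace.Subtype.secondCountableTopology _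
  set ν : Measure ↥((borelTriple σ J hJ).N) := Measure.haar with hν
  set νbar : Measure ↥(((borelTriple σ J hJ).N).map (MulAut.conj (weylLongU σ hJ)).toMonoidHom) := Measure.haar with hνbar
  -- the slice `f_t` is continuous and a cusp form along `N` and `N̄` (★ p861233)
  have hf : Continuous fun x : ↥(unitaryGroupOfForm σ J) => B u' (ρ (x * t * x⁻¹) u) :=
    K2E3SupercuspOrbitalSliceCuspidalModelTwo.continuous_coeff_conj σ ρ hsm B t u u'
  have hcusp : ∀ x : ↥(unitaryGroupOfForm σ J), ∫ n : ↥((borelTriple σ J hJ).N),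
      (fun x : ↥(unitaryGroupOfForm σ J) => B u' (ρ (x * t * x⁻¹) u)) (x * ↑n) ∂ν = 0 := fun x =>
    K2E3SupercuspOrbitalSliceCuspidalModelTwo.integral_coeff_slice_unipotentU_eq_zero_of_isSupercuspidal σ hσc hJ hZs hZc hϖ'0 hϖ'1 hσϖ'
      ρ hsm hsc B hBinv ν t hd hreg u u' x
  have hcuspbar : ∀ x : ↥(unitaryGroupOfForm σ J), ∫ v : ↥(((borelTriple σ J hJ).N).map (MulAut.conj (weylLongU σ hJ)).toMonoidHom),
      (fun x : ↥(unitaryGroupOfForm σ J) => B u' (ρ (x * t * x⁻¹) u)) (x * ↑v) ∂νbar = 0 := fun x =>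
    K2E3SupercuspOrbitalSliceCuspidalModelTwo.integral_coeff_slice_unipotentU_map_conj_weylLongU_eq_zero_of_isSupercuspidal σ hσc hJ hZs hZc
      hϖ'0 hϖ'1 hσϖ' ρ hsm hsc B hBinv νbar t hd hreg u u' x
  -- THEOREM 20 on the full level `K₁`, explicit radius (★ K2E3-p32 (g0) `cuspForm_cancellation_levelOne_U2`)
  have h20 : ∀ x : ↥(unitaryGroupOfForm σ J), x ∉ Ω (mC + (1 + 2 * s + 4 * mC) + s) →
      ∫ k in (((congruenceGL 2 (1 : ValueGroupWithZero K)).comap (unitaryGroupOfForm σ J).subtype : Subgroup ↥(unitaryGroupOfForm σ J)) :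
        Set ↥(unitaryGroupOfForm σ J)), (fun x : ↥(unitaryGroupOfForm σ J) => B u' (ρ (x * t * x⁻¹) u)) (x * k * y) ∂μ = 0 := fun x hx =>
    K2E3CuspFormCancellationU2LevelOne.cuspForm_cancellation_levelOne_U2 σ hσc hσv hJ μ ν νbar hϖ Ω hmem hinv hmul hy
      (fun x : ↥(unitaryGroupOfForm σ J) => B u' (ρ (x * t * x⁻¹) u)) hf C hCΩ hsupp hcusp hcuspbar hx
  exact K2E3SupercuspidalTruncatedCharThm20RadiusTwo.setIntegral_sdiff_heightBall_conj_eq_zero_of_levelOne σ hσc μ ϖ Ω hmem hinv hmul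
    (fun g : ↥(unitaryGroupOfForm σ J) => B u' (ρ g u)) t y hf n h20

set_option synthInstance.maxHeartbeats 400000 in
set_option maxHeartbeats 1600000 in
-- as above
/-- **(M5d)₂ THE TWO CONSUMER SHAPES WITH EXPLICIT RADIUS** at a split-regular `g = y t y⁻¹` (`y ∈ Ω s`, slice support `⊆ C·T`, `C ⊆ Ω m_C`): with
`R := m_C + (1 + 2s + 4m_C) + s`, `Θₙ(g) = ∫_{Ω n ∩ Ω R} θ(x g x⁻¹) dμ` for every `n` and `Θₙ(g) → Θ_R(g)` — the `3 ↦ 2` image of ★ (M5d)'s second head (the shape ★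
`K2E3SupercuspidalTruncatedCharRadiusDatum[Two]` reads). [cite: HarishChandra1970, Part VII §3 p. 71 eq. (1), p. 72] -/
theorem truncatedCoeff_eq_inter_and_tendsto_of_subset [SecondCountableTopology K] [SecondCountableTopology (GL (Fin 2) K)]
    [MeasurableSpace K] [BorelSpace K]
    (σ : K →+* K) (_hσ : ∀ x, σ (σ x) = x) (hσc : Continuous σ) (hσv : ∀ x, Valued.v (σ x) = Valued.v x) (_h2 : (2 : K) ≠ 0)
    {J : Matrix (Fin 2) (Fin 2) K} (hJ : J = (StdForm.antidiagonal 2).over K)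
    [MeasurableSpace ↥(unitaryGroupOfForm σ J)] [BorelSpace ↥(unitaryGroupOfForm σ J)]
    [SecondCountableTopology ↥(unitaryGroupOfForm σ J)] [LocallyCompactSpace ↥(unitaryGroupOfForm σ J)]
    (μ : Measure ↥(unitaryGroupOfForm σ J)) [μ.IsHaarMeasure] [μ.IsMulRightInvariant]
    {ϖ : K} (hϖ : Valued.v ϖ = WithZero.exp (-1 : ℤ)) {ϖ' : K} (hϖ'0 : ϖ' ≠ 0) (hϖ'1 : valuation K ϖ' < 1) (hσϖ' : σ ϖ' = ϖ')
    (hZs : ∀ z ∈ Subgroup.center ↥(unitaryGroupOfForm σ J), ∃ c : Kˣ,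
      ((z : ↥(unitaryGroupOfForm σ J)) : GL (Fin 2) K) = Matrix.GeneralLinearGroup.scalar (Fin 2) c)
    (hZc : IsCompact ((Subgroup.center ↥(unitaryGroupOfForm σ J) : Subgroup ↥(unitaryGroupOfForm σ J)) : Set ↥(unitaryGroupOfForm σ J)))
    (Ω : CompactExhaustion ↥(unitaryGroupOfForm σ J))
    (hmem : ∀ (m : ℕ) (g : ↥(unitaryGroupOfForm σ J)), g ∈ Ω m ↔
      (∀ i j, Valued.v (ϖ ^ m * ((g : GL (Fin 2) K) : Matrix (Fin 2) (Fin 2) K) i j) ≤ 1) ∧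
        ∀ i j, Valued.v (ϖ ^ m * (((g : GL (Fin 2) K)⁻¹ : GL (Fin 2) K) : Matrix (Fin 2) (Fin 2) K) i j) ≤ 1)
    (hinv : ∀ (m : ℕ) (g : ↥(unitaryGroupOfForm σ J)), g ∈ Ω m → g⁻¹ ∈ Ω m)
    (hmul : ∀ (a b : ℕ) (g h : ↥(unitaryGroupOfForm σ J)), g ∈ Ω a → h ∈ Ω b → g * h ∈ Ω (a + b))
    {V : Type*} [AddCommGroup V] [Module ℂ V] (ρ : Representation ℂ ↥(unitaryGroupOfForm σ J) V) (hsm : ρ.IsSmooth) (hsc : ρ.IsSupercuspidal)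
    (B : V →ₗ⋆[ℂ] V →ₗ[ℂ] ℂ) (hBinv : ∀ (g : ↥(unitaryGroupOfForm σ J)) (x y : V), B (ρ g x) (ρ g y) = B x y) (u u' : V)
    (t : ↥(unitaryGroupOfForm σ J)) {d : Fin 2 → Kˣ} (hd : glDiagonal 2 K d = (t : GL (Fin 2) K)) (hreg : IsRegularElt (t : GL (Fin 2) K))
    (C : Set ↥(unitaryGroupOfForm σ J)) {mC : ℕ} (hCΩ : C ⊆ Ω mC)
    (hsupp : ∀ x : ↥(unitaryGroupOfForm σ J), B u' (ρ (x * t * x⁻¹) u) ≠ 0 →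
      x ∈ C * ((torusU σ J : Subgroup ↥(unitaryGroupOfForm σ J)) : Set ↥(unitaryGroupOfForm σ J)))
    {s : ℕ} {y : ↥(unitaryGroupOfForm σ J)} (hy : y ∈ Ω s) :
    (∀ n : ℕ, ∫ x in Ω n, B u' (ρ (x * (y * t * y⁻¹) * x⁻¹) u) ∂μ =
        ∫ x in Ω n ∩ Ω (mC + (1 + 2 * s + 4 * mC) + s), B u' (ρ (x * (y * t * y⁻¹) * x⁻¹) u) ∂μ) ∧
      Tendsto (fun n : ℕ => ∫ x in Ω n, B u' (ρ (x * (y * t * y⁻¹) * x⁻¹) u) ∂μ) atTop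
        (𝓝 (∫ x in Ω (mC + (1 + 2 * s + 4 * mC) + s), B u' (ρ (x * (y * t * y⁻¹) * x⁻¹) u) ∂μ)) := by
  haveI : T2Space K := (Literature.NumberTheory.GaloisRepresentations.IsNonarchimedeanLocalField.isLocalField K).toT2Space
  -- `N` and `N̄` are closed subgroups of the locally compact `U`: Haar measures on both
  have hN : IsClosed (((borelTriple σ J hJ).N : Subgroup ↥(unitaryGroupOfForm σ J)) : Set ↥(unitaryGroupOfForm σ J)) :=
    (isClosed_upperUnitriangular (n := 2) (R := K)).preimage continuous_subtype_val
  have hNbar : IsClosed ((((borelTriple σ J hJ).N).map (MulAut.conj (weylLongU σ hJ)).toMonoidHom : Subgroup ↥(unitaryGroupOfForm σ J)) :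
      Set ↥(unitaryGroupOfForm σ J)) := by
    have himg : ((((borelTriple σ J hJ).N).map (MulAut.conj (weylLongU σ hJ)).toMonoidHom : Subgroup ↥(unitaryGroupOfForm σ J)) :
        Set ↥(unitaryGroupOfForm σ J)) =
        ((Homeomorph.mulLeft (weylLongU σ hJ)).trans (Homeomorph.mulRight (weylLongU σ hJ)⁻¹)) ''
          (((borelTriple σ J hJ).N : Subgroup ↥(unitaryGroupOfForm σ J)) : Set ↥(unitaryGroupOfForm σ J)) := by
      rw [Subgroup.coe_map]
      rfl
    rw [himg]
    exact (Homeomorph.isClosed_image _).2 hN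
  haveI : LocallyCompactSpace ↥((borelTriple σ J hJ).N) := hN.isClosedEmbedding_subtypeVal.locallyCompactSpace
  haveI : LocallyCompactSpace ↥(((borelTriple σ J hJ).N).map (MulAut.conj (weylLongU σ hJ)).toMonoidHom) :=
    hNbar.isClosedEmbedding_subtypeVal.locallyCompactSpace
  haveI : SecondCountableTopology ↥((borelTriple σ J hJ).N) := TopologicalSpace.Subtype.secondCountableTopology _
  haveI : SecondCountableTopology ↥(((borelTriple σ J hJ).N).map (MulAut.conj (weylLongU σ hJ)).toMonoidHom) :=
    TopologicalSpace.Subtype.secondCountableTopology _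
  set ν : Measure ↥((borelTriple σ J hJ).N) := Measure.haar with hν
  set νbar : Measure ↥(((borelTriple σ J hJ).N).map (MulAut.conj (weylLongU σ hJ)).toMonoidHom) := Measure.haar with hνbar
  -- the slice `f_t` is continuous and a cusp form along `N` and `N̄` (★ p861233)
  have hf : Continuous fun x : ↥(unitaryGroupOfForm σ J) => B u' (ρ (x * t * x⁻¹) u) :=
    K2E3SupercuspOrbitalSliceCuspidalModelTwo.continuous_coeff_conj σ ρ hsm B t u u'
  have hcusp : ∀ x : ↥(unitaryGroupOfForm σ J), ∫ n : ↥((borelTriple σ J hJ).N),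
      (fun x : ↥(unitaryGroupOfForm σ J) => B u' (ρ (x * t * x⁻¹) u)) (x * ↑n) ∂ν = 0 := fun x =>
    K2E3SupercuspOrbitalSliceCuspidalModelTwo.integral_coeff_slice_unipotentU_eq_zero_of_isSupercuspidal σ hσc hJ hZs hZc hϖ'0 hϖ'1 hσϖ'
      ρ hsm hsc B hBinv ν t hd hreg u u' x
  have hcuspbar : ∀ x : ↥(unitaryGroupOfForm σ J), ∫ v : ↥(((borelTriple σ J hJ).N).map (MulAut.conj (weylLongU σ hJ)).toMonoidHom),
      (fun x : ↥(unitaryGroupOfForm σ J) => B u' (ρ (x * t * x⁻¹) u)) (x * ↑v) ∂νbar = 0 := fun x =>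
    K2E3SupercuspOrbitalSliceCuspidalModelTwo.integral_coeff_slice_unipotentU_map_conj_weylLongU_eq_zero_of_isSupercuspidal σ hσc hJ hZs hZc
      hϖ'0 hϖ'1 hσϖ' ρ hsm hsc B hBinv νbar t hd hreg u u' x
  -- THEOREM 20 on the full level `K₁`, explicit radius (★ K2E3-p32 (g0) `cuspForm_cancellation_levelOne_U2`)
  have h20 : ∀ x : ↥(unitaryGroupOfForm σ J), x ∉ Ω (mC + (1 + 2 * s + 4 * mC) + s) →
      ∫ k in (((congruenceGL 2 (1 : ValueGroupWithZero K)).comap (unitaryGroupOfForm σ J).subtype : Subgroup ↥(unitaryGroupOfForm σ J)) :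
        Set ↥(unitaryGroupOfForm σ J)), (fun x : ↥(unitaryGroupOfForm σ J) => B u' (ρ (x * t * x⁻¹) u)) (x * k * y) ∂μ = 0 := fun x hx =>
    K2E3CuspFormCancellationU2LevelOne.cuspForm_cancellation_levelOne_U2 σ hσc hσv hJ μ ν νbar hϖ Ω hmem hinv hmul hy
      (fun x : ↥(unitaryGroupOfForm σ J) => B u' (ρ (x * t * x⁻¹) u)) hf C hCΩ hsupp hcusp hcuspbar hx
  exact K2E3SupercuspidalTruncatedCharThm20RadiusTwo.truncated_conj_eq_inter_and_tendsto_of_levelOne σ hσc μ ϖ Ω hmem hinv hmul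
    (fun g : ↥(unitaryGroupOfForm σ J) => B u' (ρ g u)) t y hf h20

end Summit.HodgeConjecture.HodgeConjecture.Cruxes.H413.K2E3SupercuspidalTruncatedCharThm20RadiusTwoCoeff

end
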